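import Summits.RiemannHypothesis.RiemannHypothesis.Theorems.WeilFormatCDataKitCB
import Summits.RiemannHypothesis.RiemannHypothesis.Theorems.WeilFormatCDataRungPiecesA
import HarnessLib

/-!
# Format C: the column-band kernel front door WITH A COMPRESSED MIDDLE (kit `CBM`, door `_piecesA`)

Helper file of the rh-explicit Weil-positivity programme (`--supports stmt-RiemannHypothesis-0098`; seat
rh-explicit-weil-2 gen7), RH-free, no definitions, no named facts.

`weilPositivityOn_of_kitCB` (door `_kernelsA`) subtracts EXACT coupling columns on `[B, B₃)` and an analytic tail from
`B₃`.  This twin composes weil-10's three-piece door `WeilFormatC.weilPositivityOn_of_formatC_piecesA` (p340268) with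
the same column-band evaluator: exact certified columns on `[B, B₃)` only (`K = B₃ − B` digits per row), a COMPRESSED
MIDDLE `[B₃, B₄)` (`hUmid` premise, e.g. `even/odd_middle_majorant_Umid` = weil-10's `…middleJ_majorant_matrix`) whose
per-column weights are the SAME certified reciprocal dyadic list `v` (now of length `K' = B₄ − B`), and the analytic tail
from `B₄` with the floor `d₀ ≤ d̂(B₄)`.  The Schur step is unchanged: `U₂ := U_mid + U_tail` enters through ONE
factorisation `Σ_r φ_r ψ_rᵀ + diag` (`hface`/`hfaco`) on certified factor data, so the long exact-column range of a plain
`CB` rung is replaced by the `(2J)²+1` light-table moments of the middle (Literature part XI).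

* `weilPositivityOn_of_kitCBM`.
-/

set_option linter.dupNamespace false
set_option autoImplicit false

noncomputable section

open Complex Finset Matrix
open scoped Real BigOperators ComplexConjugate ArithmeticFunction.vonMangoldt

namespace Summit.RiemannHypothesis.RiemannHypothesis.Theorems.WeilFormatC

open Literature.NumberTheory.LFunctions Literature.NumberTheory.LFunctions.Yoshida1992
  Literature.NumberTheory.LFunctions.Yoshida1992.Encl Literature.Analysis.SpecialFunctions
  Literature.Analysis.ValidatedNumerics.NumericsMP

variable {a : ℝ} {S : ℕ} {ks : List PrimeLen} {C : Consts} {F : FDConsts}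

/-- **`WeilPositivityOn a` from the column-band data kit with a compressed middle** (door `_piecesA`).  Per sector:
exact columns `[B, B+K)`, middle `[B+K, B+K')` weighted by the same certified list `v`, tail from `B+K'` with floor
`d₀ = d0z·2^{−cd} ≤ d̂(B+K')`; `U_mid + U_tail = Σ_r φ_r ψ_rᵀ + diag` is what the Schur bands certify. -/
theorem weilPositivityOn_of_kitCBM (ha : 0 < a)
    {A : ℝ} (hPA : ∀ (s : Finset ℤ) (c : ℤ → ℂ),
      -(A * ∑ n ∈ s, ‖c n‖ ^ 2) ≤ ∑ n ∈ s, ∑ m ∈ s, (conj (c n) * c m).re * primeCoeff a n m)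
    (hS : 0 < S) (hC : ConstsValid S a ks C) (hF : FDValidA S a A F) {tab : List IdxRec}
    -- ===== EVEN sector =====
    {Be Ke Kpe B3e B4e : ℕ} (hBe : 2 ≤ Be) (hKe : Be + Ke = B3e) (hKpe : Be + Kpe = B4e) (hKKe : Ke ≤ Kpe)
    (hTe : TabValid S a ks (Be + 1) tab) {ctabE : List IdxRec} (hCTe : TabColValid S a ks Be (B4e + 1) ctabE)
    {cde d0ze pe qe : ℕ} (hd0ze : 0 < d0ze) (hsqe : checkSqrtUpper 8 (Be - 1) pe qe = true)
    (h0e : 0 < (devEvenBox S C F (tget tab Be) Be pe qe).lo)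
    (hd0e : (d0ze : ℤ) * (S : ℤ) ≤ (devEvenBox S C F (tget ctabE B4e) B4e pe qe).lo * 2 ^ cde)
    {cve : ℕ} {ve : List ℕ} (hWe : checkWeightsEvenV S C F ctabE Be Kpe cve ve pe qe = true)
    -- middle: majorant premise for the weights `wvF ve cve Be` on `[B3e, B4e)`
    (UmE : ℕ → ℕ → ℝ)
    (hUmE : ∀ d : ℕ → ℝ, (∀ m, B3e ≤ m → m < B4e → 0 < wvF ve cve Be m ∧ wvF ve cve Be m ≤ d m) → ∀ x : Fin Be → ℝ,
      ∑ m ∈ Finset.Ico B3e B4e, (∑ i : Fin Be, (if (i : ℕ) = 0 then gramCoeff a 0 m else if m = 0 then gramCoeff a i 0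
        else (gramCoeff a i m + gramCoeff a i (-(m : ℤ))) / 2) * x i) ^ 2 / d m
        ≤ x ⬝ᵥ (Matrix.of fun i j : Fin Be ↦ UmE i j) *ᵥ x)
    -- tail from `B4e`
    (U2E : ℕ → ℕ → ℝ)
    (hU2E : ∀ d : ℕ → ℝ, (∀ m, B4e ≤ m → (d0ze : ℝ) * (1 / 2 ^ cde) ≤ d m) → ∀ (N : ℕ) (x : Fin Be → ℝ),
      ∑ m ∈ Finset.Ico B4e N, (∑ i : Fin Be, (if (i : ℕ) = 0 then gramCoeff a 0 m else if m = 0 then gramCoeff a i 0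
        else (gramCoeff a i m + gramCoeff a i (-(m : ℤ))) / 2) * x i) ^ 2 / d m
        ≤ x ⬝ᵥ (Matrix.of fun i j : Fin Be ↦ U2E i j) *ᵥ x)
    {R2e : ℕ} (φe ψe : ℕ → ℕ → ℝ) (dge : ℕ → ℝ)
    (hface : ∀ i < Be, ∀ j < Be, UmE i j + U2E i j = (∑ r ∈ Finset.range R2e, φe i r * ψe j r) + (if i = j then dge i else 0))
    {ce : ℕ} {ρe δe : ℤ} {DSe Le : List (List ℤ)}
    (hSe : SchurNearG (sectorKernel false (gramCoeff a))
      (usubCB (sectorKernel false (gramCoeff a)) φe ψe dge Be Ke cve ve R2e) Be ce ρe DSe false Be)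
    (hPe : PsdDyadic.checkPsdMid Be δe ρe DSe Le = true)
    -- ===== ODD sector =====
    {Bo Ko Kpo B3o B4o : ℕ} (hBo : 1 ≤ Bo) (hKo : Bo + Ko = B3o) (hKpo : Bo + Kpo = B4o) (hKKo : Ko ≤ Kpo)
    {ctabO : List IdxRec} (hCTo : TabColValid S a ks Bo (B4o + 2) ctabO)
    {cdo d0zo po qo Ksero qr : ℕ} {rso : List ℕ} (hd0zo : 0 < d0zo) (hsqo : checkSqrtUpper 8 Bo po qo = true)
    (h0o : 0 < (devOddBox S C F (tget ctabO (Bo + 1)) Bo Bo po qo).lo)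
    (hd0o : (d0zo : ℤ) * (S : ℤ) ≤ (devOddBox S C F (tget ctabO (B4o + 1)) B4o Bo po qo).lo * 2 ^ cdo)
    {cvo : ℕ} {vo : List ℕ} (hWo : checkWeightsOddV S Ksero C F ctabO Bo Kpo cvo vo rso qr po qo = true)
    (UmO : ℕ → ℕ → ℝ)
    (hUmO : ∀ d : ℕ → ℝ, (∀ l, B3o ≤ l → l < B4o → 0 < wvF vo cvo Bo l ∧ wvF vo cvo Bo l ≤ d l) → ∀ x : Fin Bo → ℝ,
      ∑ l ∈ Finset.Ico B3o B4o, (∑ k : Fin Bo, ((gramCoeff a (((k : ℕ) : ℤ) + 1) ((l : ℤ) + 1)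
        - gramCoeff a (((k : ℕ) : ℤ) + 1) (-((l : ℤ) + 1))) / 2) * x k) ^ 2 / d l
        ≤ x ⬝ᵥ (Matrix.of fun k k' : Fin Bo ↦ UmO k k') *ᵥ x)
    (U2O : ℕ → ℕ → ℝ)
    (hU2O : ∀ d : ℕ → ℝ, (∀ l, B4o ≤ l → (d0zo : ℝ) * (1 / 2 ^ cdo) ≤ d l) → ∀ (N : ℕ) (x : Fin Bo → ℝ),
      ∑ l ∈ Finset.Ico B4o N, (∑ k : Fin Bo, ((gramCoeff a (((k : ℕ) : ℤ) + 1) ((l : ℤ) + 1)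
        - gramCoeff a (((k : ℕ) : ℤ) + 1) (-((l : ℤ) + 1))) / 2) * x k) ^ 2 / d l
        ≤ x ⬝ᵥ (Matrix.of fun k k' : Fin Bo ↦ U2O k k') *ᵥ x)
    {R2o : ℕ} (φo ψo : ℕ → ℕ → ℝ) (dgo : ℕ → ℝ)
    (hfaco : ∀ k < Bo, ∀ k' < Bo, UmO k k' + U2O k k' = (∑ r ∈ Finset.range R2o, φo k r * ψo k' r) + (if k = k' then dgo k else 0))
    {co : ℕ} {ρo δo : ℤ} {DSo Lo : List (List ℤ)}
    (hSo : SchurNearG (sectorKernel true (gramCoeff a))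
      (usubCB (sectorKernel true (gramCoeff a)) φo ψo dgo Bo Ko cvo vo R2o) Bo co ρo DSo false Bo)
    (hPo : PsdDyadic.checkPsdMid Bo δo ρo DSo Lo = true) :
    WeilPositivityOn a := by
  subst hKe hKo hKpe hKpo
  have hSr : (0 : ℝ) < S := by exact_mod_cast hS
  -- ===== EVEN numeric facts =====
  have hBe1 : 1 ≤ Be := by omega
  have hreBe : MI.mem S (reDigammaQuarter (freq a Be)) (tget tab Be).reP := (hTe Be (by omega)).2.reP
  have hreB4e : MI.mem S (reDigammaQuarter (freq a (Be + Kpe))) (tget ctabE (Be + Kpe)).reP :=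
    (hCTe (Be + Kpe) (by omega) (by omega)).2
  have hloBe := devEvenBox_lo_le_A hS ha hC hF hreBe (by omega) hsqe
  have hloB4e := devEvenBox_lo_le_A hS ha hC hF hreB4e (by omega) hsqe
  have h0e' : 0 < devEvenA a A Be Be := by
    have : (0 : ℝ) < (devEvenBox S C F (tget tab Be) Be pe qe).lo := by exact_mod_cast h0e
    nlinarith
  have hd0e' : (d0ze : ℝ) * (1 / 2 ^ cde) ≤ devEvenA a A Be (Be + Kpe) := dyadic_le_of_lo hS hd0e hloB4e
  have hd0pos : (0 : ℝ) < (d0ze : ℝ) * (1 / 2 ^ cde) := by positivity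
  have hwe : ∀ m, Be ≤ m → m < Be + Kpe → 0 < wvF ve cve Be m ∧ wvF ve cve Be m ≤ devEvenA a A Be m := by
    intro m hm hmK
    obtain ⟨hvpos, hvle⟩ := weightsEvenV_of_check hWe (m - Be) (by omega)
    rw [show Be + (m - Be) = m by omega] at hvle
    have hre : MI.mem S (reDigammaQuarter (freq a m)) (tget ctabE m).reP := (hCTe m hm (by omega)).2
    have hlo := devEvenBox_lo_le_A hS ha hC hF hre (by omega) hsqe (Be := Be) (p := pe) (q := qe)
    have := wv_le_of_lo hS hvpos hvle hlo
    simpa only [wvF] using this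
  -- ===== ODD numeric facts =====
  have hreBo : MI.mem S (reDigammaQuarter (freq a ((Bo : ℤ) + 1))) (tget ctabO (Bo + 1)).reP := by
    have h := (hCTo (Bo + 1) (by omega) (by omega)).2
    push_cast at h; exact h
  have hreB4o : MI.mem S (reDigammaQuarter (freq a (((Bo + Kpo : ℕ) : ℤ) + 1))) (tget ctabO (Bo + Kpo + 1)).reP := by
    have h := (hCTo (Bo + Kpo + 1) (by omega) (by omega)).2
    push_cast at h ⊢; exact h
  have hloBo := devOddBox_lo_le_A hS ha hC hF hreBo (by omega) hsqo
  have hloB4o := devOddBox_lo_le_A hS ha hC hF hreB4o (by omega) hsqo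
  have h0o' : 0 < devOdd0A a A Bo Bo := by
    have : (0 : ℝ) < (devOddBox S C F (tget ctabO (Bo + 1)) Bo Bo po qo).lo := by exact_mod_cast h0o
    nlinarith
  have hd0o' : (d0zo : ℝ) * (1 / 2 ^ cdo) ≤ devOdd0A a A Bo (Bo + Kpo) := dyadic_le_of_lo hS hd0o hloB4o
  have hd0opos : (0 : ℝ) < (d0zo : ℝ) * (1 / 2 ^ cdo) := by positivity
  have hwo : ∀ l, Bo ≤ l → l < Bo + Kpo → 0 < wvF vo cvo Bo l ∧ wvF vo cvo Bo l ≤ devOddAA a A Bo l := by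
    intro l hl hlK
    obtain ⟨hvpos, hsq, Y, hY, hvle⟩ := weightsOddV_of_check hWo (l - Bo) (by omega)
    rw [show Bo + (l - Bo) = l by omega] at hsq hY
    have hre : MI.mem S (reDigammaQuarter (freq a ((l : ℤ) + 1))) (tget ctabO (l + 1)).reP := by
      have h := (hCTo (l + 1) (by omega) (by omega)).2
      push_cast at h; exact h
    have hlo := devOddABox_lo_le_A hS ha hC hF hre (by omega) hsq hsqo hY
    have := wv_le_of_lo hS hvpos hvle hlo
    simpa only [wvF] using this
  -- ===== the door =====
  refine weilPositivityOn_of_formatC_piecesA ha hPA hBe (Nat.le_add_right Be Ke) (by omega : Be + Ke ≤ Be + Kpe)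
    (d0e := (d0ze : ℝ) * (1 / 2 ^ cde)) (wvF ve cve Be) (wvF ve cve Be) ?_ ?_ ?_ ?_
    (Matrix.of fun i j : Fin Be ↦ UmE i j) hUmE (Matrix.of fun i j : Fin Be ↦ U2E i j) hU2E ?_
    hBo (Nat.le_add_right Bo Ko) (by omega : Bo + Ko ≤ Bo + Kpo)
    (d0o := (d0zo : ℝ) * (1 / 2 ^ cdo)) (wvF vo cvo Bo) (wvF vo cvo Bo) ?_ ?_ ?_ ?_
    (Matrix.of fun k k' : Fin Bo ↦ UmO k k') hUmO (Matrix.of fun k k' : Fin Bo ↦ U2O k k') hU2O ?_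
  · -- h0e
    have h := h0e'; unfold devEvenA at h; exact h
  · -- hd0e
    refine ⟨hd0pos, ?_⟩
    have h := hd0e'; unfold devEvenA at h; exact_mod_cast h
  · -- hwe (exact range)
    intro m hm hmK
    have h := hwe m hm (by omega)
    unfold devEvenA at h; exact h
  · -- hwme (middle range)
    intro m hm hmK
    have h := hwe m (by omega) hmK
    unfold devEvenA at h; exact h
  · -- hSe
    intro x
    have hP := PsdDyadic.psd_of_checkPsdMid hPe (u := 1 / 2 ^ ce) (by positivity)
      (fun i j : Fin Be ↦ schurEntryG (sectorKernel false (gramCoeff a))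
        (usubCB (sectorKernel false (gramCoeff a)) φe ψe dge Be Ke cve ve R2e) i j)
      (fun i j ↦ hSe i i.isLt i.isLt j j.isLt (fun h ↦ absurd h (by decide))) x
    refine le_of_le_of_eq hP (Finset.sum_congr rfl fun i _ ↦ Finset.sum_congr rfl fun j _ ↦ ?_)
    rw [← even_entry_eq_schurEntryG a Be Ke cve ve (fun i j ↦ UmE i j + U2E i j) φe ψe dge R2e hface i j]
    simp only [Matrix.of_apply]
    ring
  · -- h0o
    have h := h0o'; unfold devOdd0A at h; exact h
  · -- hd0o
    refine ⟨hd0opos, ?_⟩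
    have h := hd0o'; unfold devOdd0A at h; exact_mod_cast h
  · -- hwo (exact range)
    intro l hl hlK
    have h := hwo l hl (by omega)
    unfold devOddAA at h; exact h
  · -- hwmo (middle range)
    intro l hl hlK
    have h := hwo l (by omega) hlK
    unfold devOddAA at h; exact h
  · -- hSo
    intro x
    have hP := PsdDyadic.psd_of_checkPsdMid hPo (u := 1 / 2 ^ co) (by positivity)
      (fun k k' : Fin Bo ↦ schurEntryG (sectorKernel true (gramCoeff a))
        (usubCB (sectorKernel true (gramCoeff a)) φo ψo dgo Bo Ko cvo vo R2o) k k')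
      (fun k k' ↦ hSo k k.isLt k.isLt k' k'.isLt (fun h ↦ absurd h (by decide))) x
    refine le_of_le_of_eq hP (Finset.sum_congr rfl fun k _ ↦ Finset.sum_congr rfl fun k' _ ↦ ?_)
    rw [← odd_entry_eq_schurEntryG a Bo Ko cvo vo (fun k k' ↦ UmO k k' + U2O k k') φo ψo dgo R2o hfaco k k']
    simp only [Matrix.of_apply]
    ring

end Summit.RiemannHypothesis.RiemannHypothesis.Theorems.WeilFormatC

end
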